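import Literature.NumberTheory.GaloisCohomology.Howard2004.FiniteSingularNatural
import HarnessLib

/-!
# Howard 2004, Remark 1.2.4: Kolyvagin systems are functorial — the level-wise pushforward

Howard [Rem. 1.2.4, arXiv:1202.6340 Rem. 2.2.4, p. 7 L13–27]: «if `𝓛' ⊂ 𝓛` there is a map
`KS(T,F,𝓛) → KS(T,F,𝓛')`; if `H¹_F(K_v,T) ⊂ H¹_{F'}(K_v,T)` at every place there is a map
`KS(T,F,𝓛) → KS(T,F',𝓛)`; if `R → R'` is a ring homomorphism there is a map
`KS(T,F,𝓛) ⊗_R R' → KS(T ⊗_R R', F ⊗_R R', 𝓛)`», used in the proof of Thm. 2.2.10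
[arXiv Thm. 3.2.10, p. 17 L78–81]: «Remark (functorality) and Lemma (local comparison) yield a map
`KS(𝐓, F_Λ, 𝓛_s(𝐓)) → KS(T_𝔭, F_𝔭, 𝓛_s(T_𝔭))`».

This file proves the ONE statement behind all three maps, for the tree's `LevelData.KS`
(`Howard2004/SelmerTriples.lean`, Def. 1.2.3 with display (ks relations)), in PRESENTATION style:
given two level data `D` (on `(T, F, 𝓛)`) and `D'` (on `(T', F', 𝓛')`, any coefficient rings) and,
for every level `n`, additive maps on cohomology

* `G n : H¹(K, T/I_nT) → H¹(K, T'/I_nT')` (global), `Gv n λ` (local at `λ`), `Gs n λ` (on the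
  singular quotients `H¹_s(K_λ, ·)`),

(the two sides may use different complex embeddings `jbar`, `jbar'` for their ring class fields)
subject to the hypotheses a morphism of Selmer triples supplies — `G` carries `H¹_{F(n)}` into
`H¹_{F'(n)}` (`hsel`), commutes with the reductions `T/I_n → T/I_{nℓ}` (`hred`) and with
localisation (`hloc`), `Gs ∘ loc^s = loc^s ∘ Gv` (`hsing`), the finite–singular comparison maps
commute with the change on finite (unramified) classes (`hfs`, the naturality (ii) of
`FiniteSingularNatural`), the classes `loc_λ red(κ_n)` met by display (ks relations) are finite
(`hur`), and `𝓛' ⊆ 𝓛` (`hprimes`) — the family `κ' := (G ⊗ 1) κ` on `𝓝(𝓛')` (zero off `𝓝(𝓛')`)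
satisfies the (ks) relations of `D'` whenever `κ` satisfies those of `D` (`isKolyvaginSystem_mapFamily`),
lies in `KS(T', F', 𝓛')` whenever `κ ∈ KS(T, F, 𝓛)` (`mapFamily_mem_KS`), and has bottom class
`κ'_1 = (G ⊗ 1) κ_1` (`kappaOne_mapFamily`).  The cell's use (pub/bsd-print-x9, skeleton v9
STUB 2): the specialisation `Λ → Λ/(q_m)` of the Λ-adic Heegner Kolyvagin system to the
Eisenstein tower `T_q`, level by level, along a morphism of tower settings (lit (T3-iii)).
One definition with body (`LevelData.mapFamily`), theorems otherwise; no named fact, no instance,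
no `sorry`.  BSD is not proved by any of this.

References: B. Howard, *The Heegner point Kolyvagin system*, Compositio Math. 140 (2004),
Rem. 1.2.4, Def. 1.2.3, proof of Thm. 2.2.10 (arXiv:1202.6340, p. 7 L1–27, p. 17 L78–81).
-/

set_option autoImplicit false

noncomputable section

open Function NumberField IsDedekindDomain Field
open scoped NumberField ContRepresentation Classical TensorProduct

namespace Literature.NumberTheory.GaloisCohomology.Howard2004

open Literature.NumberTheory.GaloisRepresentations
open Literature.NumberTheory.GaloisRepresentations.DiscreteGaloisModule

namespace LevelData

variable {K : Type} [Field K] [NumberField K] {p : ℕ} [Fact p.Prime]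
  -- the source `(T, F, 𝓛)` over `R`
  {M : Type} [AddCommGroup M] [TopologicalSpace M] [DiscreteTopology M]
  {R : Type} [CommRing R] [Module R M] {ρ : DiscreteGaloisModule K M} {t : SelmerTriple p ρ}
  {N : Finset (HeightOneSpectrum (𝓞 K)) → Type} [∀ n, AddCommGroup (N n)]
  [∀ n, TopologicalSpace (N n)] [∀ n, DiscreteTopology (N n)] [∀ n, Module R (N n)]
  -- the target `(T', F', 𝓛')` over `R'`
  {M' : Type} [AddCommGroup M'] [TopologicalSpace M'] [DiscreteTopology M']
  {R' : Type} [CommRing R'] [Module R' M'] {ρ' : DiscreteGaloisModule K M'} {t' : SelmerTriple p ρ'}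
  {N' : Finset (HeightOneSpectrum (𝓞 K)) → Type} [∀ n, AddCommGroup (N' n)]
  [∀ n, TopologicalSpace (N' n)] [∀ n, DiscreteTopology (N' n)] [∀ n, Module R' (N' n)]

omit [NumberField K] in
/-- `𝓝(𝓛)` is closed under passing to divisors: `n ⊆ n' ∈ 𝓝(𝓛) ⇒ n ∈ 𝓝(𝓛)`.
[cite: Howard2004HeegnerKolyvagin, Def. 1.2.1 (arXiv p. 6, L73–75)] -/
theorem mem_levels_of_subset {P : Set (HeightOneSpectrum (𝓞 K))}
    {n n' : Finset (HeightOneSpectrum (𝓞 K))} (h : n ⊆ n') (hn' : n' ∈ levels P) :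
    n ∈ levels P :=
  fun _ hv => hn' (Finset.mem_coe.mpr (h (Finset.mem_coe.mp hv)))

omit [NumberField K] in
/-- `𝓝(𝓛') ⊆ 𝓝(𝓛)` for `𝓛' ⊆ 𝓛` (Rem. 1.2.4 (i)). [cite: Howard2004HeegnerKolyvagin, Rem. 1.2.4 (arXiv p. 7, L14–15)] -/
theorem levels_mono {P P' : Set (HeightOneSpectrum (𝓞 K))} (h : P' ⊆ P) : levels P' ⊆ levels P :=
  fun _ hn => Set.Subset.trans hn h

section Pushforward

variable (D : LevelData R ρ t N) (D' : LevelData R' ρ' t' N') (jbar jbar' : AlgebraicClosure K →+* ℂ)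
  (G : ∀ n, galoisCohomology (D.ρq n) 1 →+ galoisCohomology (D'.ρq n) 1)
  (hsel : ∀ n, ∀ c ∈ D.selmerAt jbar n, G n c ∈ D'.selmerAt jbar' n)

/-- The change of classes on the Selmer groups of the levels, `H¹_{F(n)}(K, T/I_nT) → H¹_{F'(n)}(K, T'/I_nT')`.
[cite: Howard2004HeegnerKolyvagin, Rem. 1.2.4 (arXiv p. 7, L13–27)] -/
def selmerAtMap (n : Finset (HeightOneSpectrum (𝓞 K))) :
    ↥(D.selmerAt jbar n) →+ ↥(D'.selmerAt jbar' n) :=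
  ((G n).comp (D.selmerAt jbar n).subtype).codRestrict (D'.selmerAt jbar' n) fun c => hsel n c c.2

/-- Unfolding `selmerAtMap` on the underlying classes. [cite: Howard2004HeegnerKolyvagin, Rem. 1.2.4 (arXiv p. 7, L13–27)] -/
@[simp] theorem coe_selmerAtMap (n : Finset (HeightOneSpectrum (𝓞 K))) (c : ↥(D.selmerAt jbar n)) :
    (selmerAtMap D D' jbar jbar' G hsel n c : galoisCohomology (D'.ρq n) 1) = G n c :=
  rfl

/-- The change of classes on `H¹_{F(n)}(K, T/I_nT) ⊗ G_n` (`G ⊗ 1`).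
[cite: Howard2004HeegnerKolyvagin, Rem. 1.2.4 (arXiv p. 7, L13–27)] -/
def levelMap (n : Finset (HeightOneSpectrum (𝓞 K))) :
    ↥(D.selmerAt jbar n) ⊗[ℤ] Gn (K := K) n →ₗ[ℤ] ↥(D'.selmerAt jbar' n) ⊗[ℤ] Gn (K := K) n :=
  TensorProduct.map (selmerAtMap D D' jbar jbar' G hsel n).toIntLinearMap LinearMap.id

/-- **The pushed-forward family** `κ'_n := (G ⊗ 1) κ_n` for `n ∈ 𝓝(𝓛')`, and `0` off `𝓝(𝓛')`.
[cite: Howard2004HeegnerKolyvagin, Rem. 1.2.4 (arXiv Rem. 2.2.4, p. 7, L13–27)] -/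
def mapFamily (κ : ∀ n : Finset (HeightOneSpectrum (𝓞 K)), ↥(D.selmerAt jbar n) ⊗[ℤ] Gn (K := K) n) :
    ∀ n : Finset (HeightOneSpectrum (𝓞 K)), ↥(D'.selmerAt jbar' n) ⊗[ℤ] Gn (K := K) n :=
  fun n => if n ∈ t'.levelSet then levelMap D D' jbar jbar' G hsel n (κ n) else 0

/-- `κ'_n = (G ⊗ 1) κ_n` on `𝓝(𝓛')`. [cite: Howard2004HeegnerKolyvagin, Rem. 1.2.4 (arXiv p. 7, L13–27)] -/
theorem mapFamily_apply_of_mem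
    (κ : ∀ n : Finset (HeightOneSpectrum (𝓞 K)), ↥(D.selmerAt jbar n) ⊗[ℤ] Gn (K := K) n)
    {n : Finset (HeightOneSpectrum (𝓞 K))} (hn : n ∈ t'.levelSet) :
    mapFamily D D' jbar jbar' G hsel κ n = levelMap D D' jbar jbar' G hsel n (κ n) :=
  if_pos hn

/-- `κ'_n = 0` off `𝓝(𝓛')`. [cite: Howard2004HeegnerKolyvagin, Def. 1.2.3 (arXiv p. 7, L10–12)] -/
theorem mapFamily_apply_of_not_mem
    (κ : ∀ n : Finset (HeightOneSpectrum (𝓞 K)), ↥(D.selmerAt jbar n) ⊗[ℤ] Gn (K := K) n)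
    {n : Finset (HeightOneSpectrum (𝓞 K))} (hn : n ∉ t'.levelSet) :
    mapFamily D D' jbar jbar' G hsel κ n = 0 :=
  if_neg hn

/-- **`κ'_1 = (G ⊗ 1) κ_1`** (the bottom level `n = 1` always lies in `𝓝(𝓛')`).
[cite: Howard2004HeegnerKolyvagin, Def. 1.2.3 and Rem. 1.2.4 (arXiv p. 7, L1–27)] -/
theorem kappaOne_mapFamily
    (κ : ∀ n : Finset (HeightOneSpectrum (𝓞 K)), ↥(D.selmerAt jbar n) ⊗[ℤ] Gn (K := K) n) :
    D'.kappaOne jbar' (mapFamily D D' jbar jbar' G hsel κ) = levelMap D D' jbar jbar' G hsel ∅ (D.kappaOne jbar κ) :=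
  if_pos (empty_mem_levels _)

variable
  (Gv : ∀ (n : Finset (HeightOneSpectrum (𝓞 K))) (v : HeightOneSpectrum (𝓞 K)),
    galoisCohomology ((D.ρq n).toLocal (Sum.inr v)) 1 →+ galoisCohomology ((D'.ρq n).toLocal (Sum.inr v)) 1)
  (Gs : ∀ (n : Finset (HeightOneSpectrum (𝓞 K))) (v : HeightOneSpectrum (𝓞 K)),
    SingularQuotient (GaloisRep.toLocal v (D.ρq n)) →+ SingularQuotient (GaloisRep.toLocal v (D'.ρq n)))
  (hred : ∀ (n : Finset (HeightOneSpectrum (𝓞 K))) (v : HeightOneSpectrum (𝓞 K))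
    (c : galoisCohomology (D.ρq n) 1), G (insert v n) (D.redH1 n v c) = D'.redH1 n v (G n c))
  (hloc : ∀ (n : Finset (HeightOneSpectrum (𝓞 K))) (v : HeightOneSpectrum (𝓞 K))
    (c : galoisCohomology (D.ρq n) 1),
    galoisCohomology.localization (D'.ρq n) (Sum.inr v) 1 (G n c) =
      Gv n v (galoisCohomology.localization (D.ρq n) (Sum.inr v) 1 c))
  (hsing : ∀ (n : Finset (HeightOneSpectrum (𝓞 K))) (v : HeightOneSpectrum (𝓞 K))
    (c : galoisCohomology ((D.ρq n).toLocal (Sum.inr v)) 1),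
    Gs n v (singularMap (GaloisRep.toLocal v (D.ρq n)) c) =
      singularMap (GaloisRep.toLocal v (D'.ρq n)) (Gv n v c))
  (hfs : ∀ (n : Finset (HeightOneSpectrum (𝓞 K))) (v : HeightOneSpectrum (𝓞 K)),
    ∀ c ∈ unramifiedSubgroup (GaloisRep.toLocal v (D.ρq n)) 1,
      D'.fs n v (Gv n v c) = TensorProduct.map (Gs n v).toIntLinearMap LinearMap.id (D.fs n v c))
  (hur : ∀ (n : Finset (HeightOneSpectrum (𝓞 K))) (v : HeightOneSpectrum (𝓞 K)),
    v ∉ n → insert v n ∈ t'.levelSet → ∀ c ∈ D.selmerAt jbar n,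
      galoisCohomology.localization (D.ρq (insert v n)) (Sum.inr v) 1 (D.redH1 n v c) ∈
        unramifiedSubgroup (GaloisRep.toLocal v (D.ρq (insert v n))) 1)

/-- The change of classes on the common target `(H¹_s(K_ℓ, ·) ⊗ G_ℓ) ⊗ G_n` of display (ks relations):
`(Gs ⊗ 1) ⊗ 1`. [cite: Howard2004HeegnerKolyvagin, Def. 1.2.3, display (ks relations) (arXiv p. 6, L126–140)] -/
def targetMap (n : Finset (HeightOneSpectrum (𝓞 K))) (v : HeightOneSpectrum (𝓞 K)) :
    (SingularQuotient (GaloisRep.toLocal v (D.ρq (insert v n))) ⊗[ℤ] Gell v) ⊗[ℤ] Gn (K := K) n →ₗ[ℤ]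
      (SingularQuotient (GaloisRep.toLocal v (D'.ρq (insert v n))) ⊗[ℤ] Gell v) ⊗[ℤ] Gn (K := K) n :=
  TensorProduct.map (TensorProduct.map (Gs (insert v n) v).toIntLinearMap LinearMap.id) LinearMap.id

include hred hloc hfs hur in
/-- **The upper path of (ks relations) commutes with the change**: reduce, localise at `ℓ`, apply
`φ^{fs}_ℓ ⊗ 1` — on `H¹_{F(n)} ⊗ G_n`, `upper' ∘ (G ⊗ 1) = ((Gs ⊗ 1) ⊗ 1) ∘ upper` (for `ℓ ∉ n`,
`nℓ ∈ 𝓝(𝓛')`, where the classes met are finite).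
[cite: Howard2004HeegnerKolyvagin, Def. 1.2.3, display (ks relations), and Rem. 1.2.4 (arXiv p. 6 L126 – p. 7 L27)] -/
theorem upperPath_comp_levelMap (n : Finset (HeightOneSpectrum (𝓞 K))) (v : HeightOneSpectrum (𝓞 K))
    (hv : v ∉ n) (hn : insert v n ∈ t'.levelSet) :
    D'.upperPath jbar' n v ∘ₗ levelMap D D' jbar jbar' G hsel n =
      targetMap D D' Gs n v ∘ₗ D.upperPath jbar n v := by
  simp only [upperPath, levelMap, targetMap, ← TensorProduct.map_comp, LinearMap.comp_id]
  congr 1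
  refine LinearMap.ext fun c => ?_
  simp only [LinearMap.coe_comp, Function.comp_apply, AddMonoidHom.coe_toIntLinearMap,
    AddMonoidHom.coe_comp, AddSubgroup.coe_subtype, coe_selmerAtMap]
  rw [← hred, hloc, hfs _ _ _ (hur n v hv hn c c.2)]

omit [Fact p.Prime] in
/-- The lower path with its `H¹`-component abstracted: if `B' ∘ S = g ∘ B` then
`(assoc⁻¹ ∘ (B' ⊗ E)) ∘ (S ⊗ 1) = ((g ⊗ 1) ⊗ 1) ∘ (assoc⁻¹ ∘ (B ⊗ E))` (pure tensor algebra over `ℤ`).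
[folklore] -/
private theorem lowerPath_comp_aux {S₁ S₂ H₁ H₂ P W V : Type} [AddCommGroup S₁] [AddCommGroup S₂]
    [AddCommGroup H₁] [AddCommGroup H₂] [AddCommGroup P] [AddCommGroup W] [AddCommGroup V]
    (B : S₁ →+ H₁) (B' : S₂ →+ H₂) (S : S₁ →+ S₂) (g : H₁ →+ H₂) (E : P →ₗ[ℤ] W ⊗[ℤ] V)
    (hkey : ∀ c, B' (S c) = g (B c)) :
    ((TensorProduct.assoc ℤ H₂ W V).symm.toLinearMap ∘ₗ TensorProduct.map B'.toIntLinearMap E) ∘ₗ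
        TensorProduct.map S.toIntLinearMap LinearMap.id =
      TensorProduct.map (TensorProduct.map g.toIntLinearMap LinearMap.id) LinearMap.id ∘ₗ
        ((TensorProduct.assoc ℤ H₁ W V).symm.toLinearMap ∘ₗ TensorProduct.map B.toIntLinearMap E) := by
  refine TensorProduct.ext' fun c x => ?_
  simp only [LinearMap.coe_comp, Function.comp_apply, TensorProduct.map_tmul, LinearMap.id_coe, id_eq,
    AddMonoidHom.coe_toIntLinearMap, LinearEquiv.coe_coe, hkey]
  induction E x using TensorProduct.induction_on with
  | zero => simp only [TensorProduct.tmul_zero, map_zero]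
  | tmul a b =>
      simp only [TensorProduct.assoc_symm_tmul, TensorProduct.map_tmul, LinearMap.id_coe, id_eq,
        AddMonoidHom.coe_toIntLinearMap]
  | add y z hy hz => simp only [TensorProduct.tmul_add, map_add, hy, hz]

include hloc hsing in
/-- **The lower path of (ks relations) commutes with the change**: localise at `ℓ`, pass to
`H¹_s`, rebracket `G_{nℓ} = G_n ⊗ G_ℓ` — on `H¹_{F(nℓ)} ⊗ G_{nℓ}`,
`lower' ∘ (G ⊗ 1) = ((Gs ⊗ 1) ⊗ 1) ∘ lower`.
[cite: Howard2004HeegnerKolyvagin, Def. 1.2.3, display (ks relations), and Rem. 1.2.4 (arXiv p. 6 L126 – p. 7 L27)] -/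
theorem lowerPath_comp_levelMap (n : Finset (HeightOneSpectrum (𝓞 K))) (v : HeightOneSpectrum (𝓞 K))
    (hv : v ∉ n) :
    D'.lowerPath jbar' n v hv ∘ₗ levelMap D D' jbar jbar' G hsel (insert v n) =
      targetMap D D' Gs n v ∘ₗ D.lowerPath jbar n v hv :=
  lowerPath_comp_aux _ _ _ _ _ fun c => by
    -- the `H¹`-component: `loc^s ∘ loc_ℓ ∘ G = Gs ∘ loc^s ∘ loc_ℓ` on `H¹_{F(nℓ)}`
    show singularMap (GaloisRep.toLocal v (D'.ρq (insert v n)))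
        (galoisCohomology.localization (D'.ρq (insert v n)) (Sum.inr v) 1
          (G (insert v n) (c : galoisCohomology (D.ρq (insert v n)) 1))) =
      Gs (insert v n) v (singularMap (GaloisRep.toLocal v (D.ρq (insert v n)))
        (galoisCohomology.localization (D.ρq (insert v n)) (Sum.inr v) 1
          (c : galoisCohomology (D.ρq (insert v n)) 1)))
    rw [hloc, hsing]

include hred hloc hsing hfs hur in
/-- **The (ks) relations are preserved**: if `κ` satisfies the relations of `D` on `𝓝(𝓛)`, the
pushed-forward family `κ'` satisfies those of `D'` on `𝓝(𝓛') ⊆ 𝓝(𝓛)`.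
[cite: Howard2004HeegnerKolyvagin, Def. 1.2.3 and Rem. 1.2.4 (arXiv Def. 2.2.3 / Rem. 2.2.4, p. 7, L1–27)] -/
theorem isKolyvaginSystem_mapFamily (hprimes : t'.primes ⊆ t.primes)
    (κ : ∀ n : Finset (HeightOneSpectrum (𝓞 K)), ↥(D.selmerAt jbar n) ⊗[ℤ] Gn (K := K) n)
    (hκ : D.IsKolyvaginSystem jbar κ) :
    D'.IsKolyvaginSystem jbar' (mapFamily D D' jbar jbar' G hsel κ) := by
  intro n v hv hn
  have hn₀ : n ∈ t'.levelSet := mem_levels_of_subset (Finset.subset_insert v n) hn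
  have hu := LinearMap.congr_fun
    (upperPath_comp_levelMap D D' jbar jbar' G hsel Gv Gs hred hloc hfs hur n v hv hn) (κ n)
  have hl := LinearMap.congr_fun
    (lowerPath_comp_levelMap D D' jbar jbar' G hsel Gv Gs hloc hsing n v hv) (κ (insert v n))
  simp only [LinearMap.comp_apply] at hu hl
  rw [mapFamily_apply_of_mem _ _ _ _ _ _ _ hn₀, mapFamily_apply_of_mem _ _ _ _ _ _ _ hn, hu, hl]
  have hrel : D.upperPath jbar n v (κ n) = D.lowerPath jbar n v hv (κ (insert v n)) :=
    hκ n v hv (levels_mono hprimes hn)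
  exact congrArg (targetMap D D' Gs n v) hrel

include hred hloc hsing hfs hur in
/-- **Rem. 1.2.4, the map `KS(T, F, 𝓛) → KS(T', F', 𝓛')`**: the pushed-forward family of a
Kolyvagin system is a Kolyvagin system.
[cite: Howard2004HeegnerKolyvagin, Rem. 1.2.4 (arXiv Rem. 2.2.4, p. 7, L13–27)] -/
theorem mapFamily_mem_KS (hprimes : t'.primes ⊆ t.primes)
    {κ : ∀ n : Finset (HeightOneSpectrum (𝓞 K)), ↥(D.selmerAt jbar n) ⊗[ℤ] Gn (K := K) n}
    (hκ : κ ∈ D.KS jbar) : mapFamily D D' jbar jbar' G hsel κ ∈ D'.KS jbar' :=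
  ⟨isKolyvaginSystem_mapFamily D D' jbar jbar' G hsel Gv Gs hred hloc hsing hfs hur hprimes κ hκ.1,
    fun _ hn => mapFamily_apply_of_not_mem D D' jbar jbar' G hsel κ hn⟩

end Pushforward

end LevelData

end Literature.NumberTheory.GaloisCohomology.Howard2004

end
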